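import Summits.AtomisticToContinuum.Crystallization.Theorems.FrustratedLawDichotomyStrainedPatchHomTermCalculus

/-!
# The SECOND derivative of the record potential `W₄₅` in closed form, regime by regime (input of the `λ`-leaf of lever (C))

decomp-a2c hand-1 g26 (crux `AperiodicFrustratedLawGap`, stmt-AtomisticToContinuum-27623; `(H) HomFloor (1/625)`, hcp half; critic rows 1026 (C) /
1030).  The curvature coefficients of `…HomConvexCurvature` are `β = W₄₅′(ρ)/ρ` and `α = (W₄₅″(ρ) − W₄₅′(ρ)/ρ)/ρ²` with `W₄₅″ = deriv (deriv W₄₅)`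
off the junction radii `{8/5, 3, 9/2}` (`…TaylorLeaves.junctions`).  `…HomTermCalculus` gives `W₄₅′` in closed form on the four CLOSED regimes
(`deriv_effPot45_bump/lj/window/far`); differentiating those smooth expressions on the OPEN regimes gives `W₄₅″` in closed form:

* bump `0 < r < 8/5`: `W₄₅″ = 13r⁻¹⁴ − 7r⁻⁸ − (3/128)·P″(5r/4)`, `P″(u) = −11/3 + 99/4 u² − 385/16 u³ + 693/128 u⁵ − 99/128 u⁷ + 275/6144 u⁹`;
* Lennard-Jones `8/5 < r < 3`: `W₄₅″ = 13r⁻¹⁴ − 7r⁻⁸`;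
* window `3 < r < 9/2`: `W₄₅″ = (13r⁻¹⁴ − 7r⁻⁸)·c(r) + 2(−r⁻¹³ + r⁻⁷)·c′(r) + V(r)·c″(r)` with `c = (16r³ − 180r² + 648r − 729)/27` (`= 1 − w₄₅`),
  `c′ = (16r² − 120r + 216)/9`, `c″ = (32r − 120)/9`;
* far `9/2 < r`: `W₄₅″ = 0`.

NO definitions; 0 sorry; standard axioms; no instances / notation / `#eval`.  `--supports stmt-AtomisticToContinuum-27623`.
-/

noncomputable section

namespace Summit.AtomisticToContinuum.Crystallization.Theorems.FrustratedLawDichotomyStrainedPatchHomWrecCurvature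

open Filter Topology
open Literature.MathematicalPhysics.StatisticalMechanics (lennardJones)
open Summit.AtomisticToContinuum.Crystallization.Theorems.FrustratedLawDichotomySchurCut (effPot w₄₅ ω₄)
open Summit.AtomisticToContinuum.Crystallization.Theorems.FrustratedLawDichotomyStrainedPatchHomTermCalculus
  (deriv_effPot45_bump deriv_effPot45_lj deriv_effPot45_window deriv_effPot45_far hasDerivAt_deriv_lennardJones)

/-! ## §1. Elementary derivatives (`V″ = 13r⁻¹⁴ − 7r⁻⁸` is `…HomTermCalculus.hasDerivAt_deriv_lennardJones`, reused) -/

/-- The bump-profile derivative polynomial `P′(5r/4)` has derivative `(5/4)·P″(5r/4)`. [folklore] -/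
theorem hasDerivAt_bumpPoly (r : ℝ) :
    HasDerivAt (fun s : ℝ => -(11 / 3) * (5 * s / 4) + 33 / 4 * (5 * s / 4) ^ 3 - 385 / 64 * (5 * s / 4) ^ 4 +
        231 / 256 * (5 * s / 4) ^ 6 - 99 / 1024 * (5 * s / 4) ^ 8 + 55 / 12288 * (5 * s / 4) ^ 10)
      (5 / 4 * (-(11 / 3) + 99 / 4 * (5 * r / 4) ^ 2 - 385 / 16 * (5 * r / 4) ^ 3 + 693 / 128 * (5 * r / 4) ^ 5 -
        99 / 128 * (5 * r / 4) ^ 7 + 275 / 6144 * (5 * r / 4) ^ 9)) r := by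
  have hu : HasDerivAt (fun s : ℝ => 5 * s / 4) (5 / 4 : ℝ) r := by
    simpa using ((hasDerivAt_id r).const_mul (5 : ℝ)).div_const 4
  have h := ((((((hu.const_mul (-(11 / 3) : ℝ)).fun_add ((hu.fun_pow 3).const_mul (33 / 4 : ℝ))).fun_sub
    ((hu.fun_pow 4).const_mul (385 / 64 : ℝ))).fun_add ((hu.fun_pow 6).const_mul (231 / 256 : ℝ))).fun_sub
    ((hu.fun_pow 8).const_mul (99 / 1024 : ℝ))).fun_add ((hu.fun_pow 10).const_mul (55 / 12288 : ℝ)))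
  refine h.congr_deriv ?_
  push_cast
  ring

/-! ## §2. `W₄₅″` on the four open regimes -/

/-- ★ **Lennard-Jones regime** `8/5 < r < 3`: `W₄₅″(r) = 13r⁻¹⁴ − 7r⁻⁸`. [folklore] -/
theorem hasDerivAt_deriv_effPot45_lj {r : ℝ} (h1 : 8 / 5 < r) (h2 : r < 3) :
    HasDerivAt (deriv (effPot w₄₅ ω₄ (3 / 400))) (13 * (r⁻¹) ^ 14 - 7 * (r⁻¹) ^ 8) r := by
  have heq : deriv (effPot w₄₅ ω₄ (3 / 400)) =ᶠ[𝓝 r] fun s => -(s⁻¹) ^ 13 + (s⁻¹) ^ 7 := by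
    filter_upwards [Ioo_mem_nhds h1 h2] with s hs using deriv_effPot45_lj hs.1.le hs.2.le
  exact (hasDerivAt_deriv_lennardJones (by linarith : r ≠ 0)).congr_of_eventuallyEq heq

/-- ★ **Bump regime** `0 < r < 8/5`: `W₄₅″(r) = 13r⁻¹⁴ − 7r⁻⁸ − (3/160)(5/4)·P″(5r/4)`. [folklore] -/
theorem hasDerivAt_deriv_effPot45_bump {r : ℝ} (h0 : 0 < r) (h1 : r < 8 / 5) :
    HasDerivAt (deriv (effPot w₄₅ ω₄ (3 / 400)))
      (13 * (r⁻¹) ^ 14 - 7 * (r⁻¹) ^ 8 - 3 / 160 * (5 / 4 * (-(11 / 3) + 99 / 4 * (5 * r / 4) ^ 2 - 385 / 16 * (5 * r / 4) ^ 3 +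
        693 / 128 * (5 * r / 4) ^ 5 - 99 / 128 * (5 * r / 4) ^ 7 + 275 / 6144 * (5 * r / 4) ^ 9))) r := by
  have heq : deriv (effPot w₄₅ ω₄ (3 / 400)) =ᶠ[𝓝 r] fun s => (-(s⁻¹) ^ 13 + (s⁻¹) ^ 7) - 3 / 160 * (-(11 / 3) * (5 * s / 4) +
      33 / 4 * (5 * s / 4) ^ 3 - 385 / 64 * (5 * s / 4) ^ 4 + 231 / 256 * (5 * s / 4) ^ 6 - 99 / 1024 * (5 * s / 4) ^ 8 +
      55 / 12288 * (5 * s / 4) ^ 10) := by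
    filter_upwards [Ioo_mem_nhds h0 h1] with s hs using deriv_effPot45_bump hs.1 hs.2.le
  exact ((hasDerivAt_deriv_lennardJones h0.ne').sub ((hasDerivAt_bumpPoly r).const_mul (3 / 160 : ℝ))).congr_of_eventuallyEq heq

/-- ★ **Window regime** `3 < r < 9/2`: `W₄₅″ = (13r⁻¹⁴ − 7r⁻⁸)·c + 2(−r⁻¹³ + r⁻⁷)·c′ + V·c″`, `c = (16r³ − 180r² + 648r − 729)/27`,
`c′ = (16r² − 120r + 216)/9`, `c″ = (32r − 120)/9`. [folklore] -/
theorem hasDerivAt_deriv_effPot45_window {r : ℝ} (h1 : 3 < r) (h2 : r < 9 / 2) :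
    HasDerivAt (deriv (effPot w₄₅ ω₄ (3 / 400)))
      ((13 * (r⁻¹) ^ 14 - 7 * (r⁻¹) ^ 8) * ((16 * r ^ 3 - 180 * r ^ 2 + 648 * r - 729) / 27) +
        2 * (-(r⁻¹) ^ 13 + (r⁻¹) ^ 7) * ((16 * r ^ 2 - 120 * r + 216) / 9) + lennardJones r * ((32 * r - 120) / 9)) r := by
  have hr : r ≠ 0 := by linarith
  have heq : deriv (effPot w₄₅ ω₄ (3 / 400)) =ᶠ[𝓝 r] fun s => (-(s⁻¹) ^ 13 + (s⁻¹) ^ 7) * ((16 * s ^ 3 - 180 * s ^ 2 + 648 * s - 729) / 27) +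
      lennardJones s * ((16 * s ^ 2 - 120 * s + 216) / 9) := by
    filter_upwards [Ioo_mem_nhds h1 h2] with s hs using deriv_effPot45_window hs.1.le hs.2.le
  have hid := hasDerivAt_id r
  have hc : HasDerivAt (fun s : ℝ => (16 * s ^ 3 - 180 * s ^ 2 + 648 * s - 729) / 27) ((16 * r ^ 2 - 120 * r + 216) / 9) r := by
    have h := ((((hid.fun_pow 3).const_mul (16 : ℝ)).fun_sub ((hid.fun_pow 2).const_mul (180 : ℝ))).fun_add
      (hid.const_mul (648 : ℝ))).sub_const (729 : ℝ) |>.div_const 27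
    refine h.congr_deriv ?_
    simp only [id]
    push_cast
    ring
  have hc' : HasDerivAt (fun s : ℝ => (16 * s ^ 2 - 120 * s + 216) / 9) ((32 * r - 120) / 9) r := by
    have h := ((((hid.fun_pow 2).const_mul (16 : ℝ)).fun_sub (hid.const_mul (120 : ℝ))).add_const (216 : ℝ)).div_const 9
    refine h.congr_deriv ?_
    simp only [id]
    push_cast
    ring
  -- `V′ = −r⁻¹³ + r⁻⁷` (inlined: the statement is `…PhononStabilityNegative.hasDerivAt_lennardJones`, a module not imported here)
  have hlj : HasDerivAt lennardJones (-(r⁻¹) ^ 13 + (r⁻¹) ^ 7) r := by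
    have h1 : HasDerivAt (fun s : ℝ => s⁻¹) (-(r ^ 2)⁻¹) r := hasDerivAt_inv hr
    have h := ((h1.fun_pow 12).const_mul (1 / 12 : ℝ)).fun_sub ((h1.fun_pow 6).const_mul (1 / 6 : ℝ))
    have hfun : lennardJones = fun s : ℝ => (1 / 12 : ℝ) * (s⁻¹) ^ 12 - (1 / 6 : ℝ) * (s⁻¹) ^ 6 := by
      funext s; simp [lennardJones]
    rw [hfun]
    refine h.congr_deriv ?_
    have e13 : (r⁻¹) ^ 13 = (r⁻¹) ^ 11 * (r ^ 2)⁻¹ := by rw [← inv_pow]; ring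
    have e7 : (r⁻¹) ^ 7 = (r⁻¹) ^ 5 * (r ^ 2)⁻¹ := by rw [← inv_pow]; ring
    rw [e13, e7]
    push_cast
    ring
  have h := ((hasDerivAt_deriv_lennardJones hr).mul hc).add (hlj.mul hc')
  refine (h.congr_of_eventuallyEq heq).congr_deriv ?_
  ring

/-- ★ **Far regime** `9/2 < r`: `W₄₅″(r) = 0`. [folklore] -/
theorem hasDerivAt_deriv_effPot45_far {r : ℝ} (h : 9 / 2 < r) : HasDerivAt (deriv (effPot w₄₅ ω₄ (3 / 400))) 0 r := by
  have heq : deriv (effPot w₄₅ ω₄ (3 / 400)) =ᶠ[𝓝 r] fun _ => (0 : ℝ) := by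
    filter_upwards [Ioi_mem_nhds h] with s hs using deriv_effPot45_far hs.le
  exact (hasDerivAt_const r (0 : ℝ)).congr_of_eventuallyEq heq

end Summit.AtomisticToContinuum.Crystallization.Theorems.FrustratedLawDichotomyStrainedPatchHomWrecCurvature

end
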